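import Literature.Probability.LatticeModels.StarComponents
import Literature.Probability.LatticeModels.LatticeAnimalsGraph
import HarnessLib

/-!
# Contour geometry for the chessboard–Peierls argument: `★`-connected sets of bad blocks around a
# point, in a periodic colouring of `ℤ^d`

Support file for the Theorem 4.3 line of the barrier
`Literature/Barriers/CriticalPhenomena/PositionSpaceRGNonGibbsian.lean` (van Enter–Fernández–Sokal
1993, Theorem 4.3: the `+` phase of the internal spins with alternating image spins, `b ≥ 3`; the
source's route is Pirogov–Sinai theory, §4.3.2 / App. B.5.3; this line of files uses reflection
positivity and a chessboard–Peierls argument on a torus instead — Fröhlich–Lieb 1978,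
Fröhlich–Israel–Lieb–Simon 1978, Friedli–Velenik 2017 Ch. 10, Biskup 2009 §5).

This file is the purely geometric step of a Peierls argument with block variables, on `ℤ^d` with
the `★`-adjacency (`‖x - y‖_∞ = 1`, `zdStar`): the blocks of the torus are lifted to a periodic
colouring of `ℤ^d` by three colours — BAD, GOOD-PLUS (`Plus`) and the rest (good-minus) — with the
one structural property that **a `★`-neighbour of a plus block which is not plus is bad** (good
blocks of opposite signs overlap, so they are never `★`-adjacent). In such a colouring:

* `exists_starConn_bad_of_chain` (**the contour lemma**): if from a non-plus block `x` a `★`-chain of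
  non-plus blocks reaches sup-distance `≥ m`, and the sup-ball of radius `r` about a block `y` is
  plus, then there is a `★`-connected finite set `W` of bad blocks with
  (a) exactly `N` blocks, or (b) at least `m + 1` and fewer than `N` blocks, one of them within
  sup-distance `#W` of `x`, or (c) at least `r + 1` and fewer than `N` blocks, one within
  sup-distance `#W` of `y` (`N ≥ 1` arbitrary here; in the application `N` is the period, and
  fewer than `N` blocks means the set projects injectively to the torus).
  Proof: let `U` be the `★`-component of `x` in the non-plus blocks and `V` that of `y` in the plus
  blocks. If `U` is finite, the interior `★`-boundary of its `★`-hull consists of blocks of `U`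
  `★`-adjacent to plus blocks, hence bad, is `★`-connected (Friedli–Velenik Lemma 7.19 / B.82, tree
  file `StarComponents`), contains the coordinate-extreme blocks of `U` and so has sup-diameter
  `≥ m`. If `V` is finite, the exterior `★`-boundary of its hull is bad, `★`-connected, and
  surrounds the ball. If both are infinite, the component `A` of `x` in `U ∩ box n` (for `n` large)
  has an interior hull boundary which is bad away from the boundary layer of the box and joins a
  block near `x` (where the straight chain from `x` to `y ∈ ext A` leaves the hull) to the layer:
  a bad `★`-chain of sup-diameter `≥ N`.
* the elementary tools: sup-distance triangle inequality, the coordinate extent of a `★`-connected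
  set is less than its cardinality (`natAbs_sub_lt_card_of_starConn`), first exit of a chain from a
  set, rays to the exterior, extraction of a `★`-connected subset of prescribed cardinality
  (`exists_subset_card_eq_of_isGraphConnected`, by growing a maximal connected proper subset), and
  the dictionary `StarConn ↔ IsGraphConnected (zdStar d)` to the tree's lattice-animal bound
  `card_le_pow_of_isGraphConnected` (Friedli–Velenik Lemma 3.38 / (5.27)).

Everything is proved; no named facts are introduced (D-0014, D-0026).

## References

* S. Friedli, Y. Velenik, *Statistical Mechanics of Lattice Systems*, CUP 2017, §7.2.6 (Lemma 7.19),
  App. B.15 (Lemmas B.81–B.83), Lemma 3.38, §10.4 [FriedliVelenik2017].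
* J. Fröhlich, E. H. Lieb, Comm. Math. Phys. 60 (1978) 233–267 (Peierls argument from chessboard
  estimates) [FrohlichLieb1978].
* A. C. D. van Enter, R. Fernández, A. D. Sokal, J. Stat. Phys. 72 (1993) 879–1167, Theorem 4.3
  [VanenterFernandezSokal1993].
-/

noncomputable section

namespace Literature.Barriers.CriticalPhenomena.NonGibbs

open Finset Relation SimpleGraph Literature.Probability.LatticeModels

variable {d : ℕ}

/-! ### Sup-distance -/

/-- Triangle inequality for the sup-distance. [folklore] -/
theorem supDist_triangle (x y z : Site d) : supDist x z ≤ supDist x y + supDist y z := by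
  rw [supDist_le_iff]
  intro i
  have h1 := natAbs_sub_le_supDist x y i
  have h2 := natAbs_sub_le_supDist y z i
  have : x i - z i = (x i - y i) + (y i - z i) := by ring
  rw [this]
  exact (Int.natAbs_add_le _ _).trans (add_le_add h1 h2)

/-- A `★`-step changes the sup-distance to a fixed point by at most one. [folklore] -/
theorem supDist_le_succ_of_adj {x y z : Site d} (h : (zdStar d).Adj y z) : supDist x z ≤ supDist x y + 1 := by
  have h1 := supDist_triangle x y z
  have h2 := (zdStar_adj.1 h).2
  omega

/-- `x + v` in coordinates. [folklore] -/
theorem supDist_add_left (x v : Site d) : supDist x (x + v) = supDist 0 v := by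
  unfold supDist; congr 1; funext i; simp

/-! ### `★`-connected sets: dictionary with `IsGraphConnected`, coordinate extent, extraction -/

/-- `StarConn` of a finite set is the tree's cut-connectedness `IsGraphConnected (zdStar d)`
(for non-empty sets; both hold for `∅`). [cite: FriedliVelenik2017, Lemma 3.38] -/
theorem starConn_iff_isGraphConnected (S : Finset (Site d)) :
    StarConn (S : Set (Site d)) ↔ IsGraphConnected (zdStar d) S := by
  rcases S.eq_empty_or_nonempty with rfl | ⟨v, hv⟩
  · exact ⟨fun _ => isGraphConnected_empty, fun _ x hx => absurd hx (by simp)⟩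
  rw [isGraphConnected_iff_reflTransGen (G := zdStar d) hv]
  constructor
  · intro h w hw
    exact h v (mem_coe.2 hv) w (mem_coe.2 hw)
  · intro h x hx y hy
    exact (reflTransGen_starRel_symm (h x (mem_coe.1 hx))).trans (h y (mem_coe.1 hy))

/-- **Discrete intermediate values along a chain**: in a `★`-connected finite set, every integer
between the `i`-th coordinates of two of its points is the `i`-th coordinate of a point of the set.
[folklore] -/
theorem exists_apply_eq_of_starConn {W : Finset (Site d)} (hW : StarConn (W : Set (Site d)))
    {u v : Site d} (hu : u ∈ W) (hv : v ∈ W) (i : Fin d) {t : ℤ}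
    (ht : min (u i) (v i) ≤ t ∧ t ≤ max (u i) (v i)) : ∃ z ∈ W, z i = t := by
  have h := hW u (mem_coe.2 hu) v (mem_coe.2 hv)
  -- induction along the chain
  suffices key : ∀ w, ReflTransGen (starRel (W : Set (Site d))) u w →
      ∀ t : ℤ, min (u i) (w i) ≤ t ∧ t ≤ max (u i) (w i) → ∃ z ∈ W, z i = t from key v h t ht
  intro w hw
  induction hw with
  | refl =>
    intro t ht
    exact ⟨u, hu, by simp only [min_self, max_self] at ht; omega⟩
  | @tail b c _ hbc ih =>
    intro t ht
    have hstep := natAbs_sub_le_one_of_adj hbc.1 i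
    by_cases hbt : min (u i) (b i) ≤ t ∧ t ≤ max (u i) (b i)
    · exact ih t hbt
    · refine ⟨c, mem_coe.1 hbc.2.2, ?_⟩
      simp only [not_and_or, not_le] at hbt
      rcases hbt with hbt | hbt
      · have : t < b i := lt_of_lt_of_le hbt (min_le_right _ _)
        have h2 : min (u i) (c i) ≤ t := ht.1
        have h3 : u i > t := lt_of_lt_of_le hbt (min_le_left _ _)
        have : c i ≤ t := by
          rcases le_total (u i) (c i) with h | h
          · rw [min_eq_left h] at h2; omega
          · rw [min_eq_right h] at h2; exact h2
        omega
      · have : b i < t := lt_of_le_of_lt (le_max_right _ _) hbt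
        have h2 : t ≤ max (u i) (c i) := ht.2
        have h3 : u i < t := lt_of_le_of_lt (le_max_left _ _) hbt
        have : t ≤ c i := by
          rcases le_total (u i) (c i) with h | h
          · rw [max_eq_right h] at h2; exact h2
          · rw [max_eq_left h] at h2; omega
        omega

/-- **The coordinate extent of a `★`-connected finite set is less than its cardinality**:
`|uᵢ - vᵢ| + 1 ≤ #W` for `u, v ∈ W`. [folklore] -/
theorem natAbs_sub_lt_card_of_starConn {W : Finset (Site d)} (hW : StarConn (W : Set (Site d)))
    {u v : Site d} (hu : u ∈ W) (hv : v ∈ W) (i : Fin d) : (u i - v i).natAbs + 1 ≤ #W := by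
  classical
  -- the coordinate `i` takes every value between `uᵢ` and `vᵢ` on `W`
  set a := min (u i) (v i)
  set n := (u i - v i).natAbs
  have hmax : max (u i) (v i) = a + n := by
    simp only [a, n]
    rcases le_total (u i) (v i) with h | h
    · rw [min_eq_left h, max_eq_right h]; omega
    · rw [min_eq_right h, max_eq_left h]; omega
  have hex : ∀ k ∈ Finset.range (n + 1), ∃ z ∈ W, z i = a + k := by
    intro k hk
    rw [Finset.mem_range] at hk
    exact exists_apply_eq_of_starConn hW hu hv i ⟨by omega, by rw [hmax]; omega⟩
  choose! f hf using hex
  calc n + 1 = #(Finset.range (n + 1)) := (Finset.card_range _).symm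
    _ ≤ #W := Finset.card_le_card_of_injOn f (fun k hk => (hf k hk).1) (by
        intro k₁ hk₁ k₂ hk₂ h
        have h1 := (hf k₁ hk₁).2
        have h2 := (hf k₂ hk₂).2
        have : (a + k₁ : ℤ) = a + k₂ := by rw [← h1, ← h2, h]
        exact_mod_cast add_left_cancel this)

/-- The sup-distance of two points of a `★`-connected finite set is less than its cardinality.
[folklore] -/
theorem supDist_lt_card_of_starConn {W : Finset (Site d)} (hW : StarConn (W : Set (Site d)))
    {u v : Site d} (hu : u ∈ W) (hv : v ∈ W) : supDist u v + 1 ≤ #W := by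
  have hne : W.Nonempty := ⟨u, hu⟩
  rcases Nat.eq_zero_or_pos d with hd | hd
  · subst hd
    have : supDist u v = 0 := by simp [supDist]
    rw [this]; exact hne.card_pos
  · obtain ⟨i, -, hi⟩ := Finset.exists_mem_eq_sup (univ : Finset (Fin d))
      ⟨⟨0, hd⟩, mem_univ _⟩ (fun i => (u i - v i).natAbs)
    change supDist u v = _ at hi
    rw [hi]
    exact natAbs_sub_lt_card_of_starConn hW hu hv i

/-- Adding an adjacent vertex to a connected set keeps it connected (cut form). [folklore] -/
theorem isGraphConnected_insert {V : Type*} [DecidableEq V] {G : SimpleGraph V} {A : Finset V}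
    (hA : IsGraphConnected G A) {a b : V} (ha : a ∈ A) (hab : G.Adj a b) :
    IsGraphConnected G (insert b A) := by
  intro A' hA' hA'ne hcne
  by_cases hb : b ∈ A
  · rw [Finset.insert_eq_of_mem hb] at hA' hcne ⊢
    exact hA A' hA' hA'ne hcne
  by_cases h1 : (A' ∩ A).Nonempty
  · by_cases h2 : (A \ A').Nonempty
    · obtain ⟨p, hp, q, hq, hpq⟩ := hA (A' ∩ A) inter_subset_right h1 (by
        obtain ⟨q, hq⟩ := h2
        exact ⟨q, by rw [mem_sdiff] at hq ⊢; exact ⟨hq.1, fun h => hq.2 (mem_inter.1 h).1⟩⟩)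
      refine ⟨p, (mem_inter.1 hp).1, q, ?_, hpq⟩
      rw [mem_sdiff] at hq ⊢
      exact ⟨mem_insert_of_mem hq.1, fun h => hq.2 (mem_inter.2 ⟨h, hq.1⟩)⟩
    · -- `A ⊆ A'`, so the complement is `{b}` and `A' ∋ a`
      have hAA' : A ⊆ A' := fun q hq => by
        by_contra hq'
        exact h2 ⟨q, mem_sdiff.2 ⟨hq, hq'⟩⟩
      obtain ⟨c, hc⟩ := hcne
      rw [mem_sdiff, mem_insert] at hc
      have hcb : c = b := by
        rcases hc.1 with h | h
        · exact h
        · exact absurd (hAA' h) hc.2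
      refine ⟨a, hAA' ha, b, mem_sdiff.2 ⟨mem_insert_self _ _, hcb ▸ hc.2⟩, hab⟩
  · -- `A' ∩ A = ∅`, so `A' = {b}`
    have hA'b : ∀ p ∈ A', p = b := by
      intro p hp
      rcases mem_insert.1 (hA' hp) with h | h
      · exact h
      · exact absurd ⟨p, mem_inter.2 ⟨hp, h⟩⟩ h1
    obtain ⟨p, hp⟩ := hA'ne
    have hpb := hA'b p hp
    subst hpb
    refine ⟨p, hp, a, mem_sdiff.2 ⟨mem_insert_of_mem ha, fun h => hb ?_⟩, hab.symm⟩
    rw [← hA'b a h]; exact ha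

/-- **Extraction of a connected subset of prescribed cardinality** (cut form, any graph): a
connected finite set `S` contains, for every `1 ≤ k ≤ #S`, a connected subset with exactly `k`
elements. Proof: a connected proper subset of maximal cardinality has `#S - 1` elements (otherwise
an edge leaving it lets it grow), and induction. [folklore] -/
theorem exists_subset_card_eq_of_isGraphConnected {V : Type*} [DecidableEq V] {G : SimpleGraph V}
    {S : Finset V} (hS : IsGraphConnected G S) {k : ℕ} (hk1 : 1 ≤ k) (hkS : k ≤ #S) :
    ∃ T ⊆ S, #T = k ∧ IsGraphConnected G T := by
  -- remove one vertex at a time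
  suffices step : ∀ (S : Finset V), IsGraphConnected G S → 2 ≤ #S →
      ∃ T ⊆ S, #T = #S - 1 ∧ IsGraphConnected G T by
    induction hn : #S - k generalizing S with
    | zero => exact ⟨S, Subset.rfl, by omega, hS⟩
    | succ n ih =>
      obtain ⟨T, hTS, hTcard, hT⟩ := step S hS (by omega)
      obtain ⟨T', hT'T, hT'card, hT'⟩ := ih hT (by omega) (by omega)
      exact ⟨T', hT'T.trans hTS, hT'card, hT'⟩
  intro S hS h2
  classical
  -- a connected proper non-empty subset of maximal cardinality
  set 𝒞 : Finset (Finset V) := S.powerset.filter fun A => A.Nonempty ∧ A ≠ S ∧ IsGraphConnected G A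
  have h𝒞ne : 𝒞.Nonempty := by
    obtain ⟨v, hv⟩ : S.Nonempty := card_pos.1 (by omega)
    refine ⟨{v}, mem_filter.2 ⟨mem_powerset.2 (singleton_subset_iff.2 hv), singleton_nonempty v, ?_,
      isGraphConnected_singleton v⟩⟩
    intro h
    have := congrArg Finset.card h
    rw [card_singleton] at this; omega
  obtain ⟨A, hA𝒞, hAmax⟩ := Finset.exists_max_image 𝒞 Finset.card h𝒞ne
  obtain ⟨hAS, hAne, hAneS, hAconn⟩ := mem_filter.1 hA𝒞
  rw [mem_powerset] at hAS
  refine ⟨A, hAS, ?_, hAconn⟩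
  have hlt : #A < #S := card_lt_card (Finset.ssubset_iff_subset_ne.2 ⟨hAS, hAneS⟩)
  by_contra hne
  have hlt2 : #A + 2 ≤ #S := by omega
  -- an edge leaving `A` inside `S`
  obtain ⟨a, ha, b, hb, hab⟩ := hS A hAS hAne (by
    rw [← Finset.card_pos, card_sdiff_of_subset hAS]; omega)
  rw [mem_sdiff] at hb
  have hins : insert b A ∈ 𝒞 := by
    refine mem_filter.2 ⟨mem_powerset.2 (insert_subset hb.1 hAS), insert_nonempty _ _, ?_,
      isGraphConnected_insert hAconn ha hab⟩
    intro h
    have := congrArg Finset.card h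
    rw [card_insert_of_notMem hb.2] at this; omega
  have := hAmax _ hins
  rw [card_insert_of_notMem hb.2] at this
  omega

/-- Extraction for `★`-connected finite sets of lattice points. [folklore] -/
theorem exists_subset_card_eq_of_starConn {S : Finset (Site d)} (hS : StarConn (S : Set (Site d)))
    {k : ℕ} (hk1 : 1 ≤ k) (hkS : k ≤ #S) :
    ∃ T ⊆ S, #T = k ∧ StarConn (T : Set (Site d)) := by
  obtain ⟨T, hTS, hTk, hT⟩ := exists_subset_card_eq_of_isGraphConnected
    ((starConn_iff_isGraphConnected S).1 hS) hk1 hkS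
  exact ⟨T, hTS, hTk, (starConn_iff_isGraphConnected T).2 hT⟩

/-! ### Chains: first exit, straight chains, rays to the exterior -/

/-- **First exit of a chain from a set**: a chain inside `S` from a point `a ∈ S ∩ H` to a point
outside `H` has an initial segment inside `S ∩ H` ending at a point `w ∈ S ∩ H` which is `★`-adjacent
to a point `w' ∈ S` outside `H`. [folklore] -/
theorem exists_exit_of_reflTransGen {S H : Set (Site d)} {a b : Site d}
    (h : ReflTransGen (starRel S) a b) (haS : a ∈ S) (ha : a ∈ H) (hb : b ∉ H) :
    ∃ w w', ReflTransGen (starRel (S ∩ H)) a w ∧ w ∈ S ∧ w ∈ H ∧ w' ∈ S ∧ w' ∉ H ∧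
      (zdStar d).Adj w w' := by
  induction h using ReflTransGen.head_induction_on with
  | refl => exact absurd ha hb
  | @head a' c hac _ ih =>
    by_cases hc : c ∈ H
    · obtain ⟨w, w', h1, h2, h3, h4, h5, h6⟩ := ih hac.2.2 hc
      exact ⟨w, w', ReflTransGen.head ⟨hac.1, ⟨hac.2.1, ha⟩, ⟨hac.2.2, hc⟩⟩ h1, h2, h3, h4, h5, h6⟩
    · exact ⟨a', c, ReflTransGen.refl, haS, ha, hac.2.2, hc, hac.1⟩

/-- Moving one coordinate monotonically to a prescribed value, inside a set containing the segment.
[folklore] -/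
theorem reflTransGen_update_of_forall_between {T : Set (Site d)} (z : Site d) (k : Fin d) (v : ℤ)
    (h : ∀ w : ℤ, min (z k) v ≤ w ∧ w ≤ max (z k) v → Function.update z k w ∈ T) :
    ReflTransGen (starRel T) z (Function.update z k v) := by
  rcases le_or_gt (z k) v with hle | hlt
  · obtain ⟨n, hn⟩ := Int.le.dest hle
    rw [← hn]
    refine reflTransGen_update_add z k n fun m hm => h _ ⟨?_, ?_⟩
    · rw [min_eq_left hle]; omega
    · rw [max_eq_right hle]; omega
  · obtain ⟨n, hn⟩ := Int.le.dest hlt.le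
    rw [show v = z k - n by omega]
    refine reflTransGen_update_sub z k n fun m hm => h _ ⟨?_, ?_⟩
    · rw [min_eq_right hlt.le]; omega
    · rw [max_eq_left hlt.le]; omega

/-- **Straight chains**: `x` is chained to `y` inside any set containing the coordinate box spanned by
`x` and `y` (move the coordinates one at a time). [folklore] -/
theorem reflTransGen_starRel_of_between {T : Set (Site d)} (x y : Site d)
    (hT : ∀ z : Site d, (∀ i, min (x i) (y i) ≤ z i ∧ z i ≤ max (x i) (y i)) → z ∈ T) :
    ReflTransGen (starRel T) x y := by
  classical
  suffices key : ∀ (n : ℕ) (z : Site d), (∀ i, min (x i) (y i) ≤ z i ∧ z i ≤ max (x i) (y i)) →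
      #(univ.filter fun k => z k ≠ y k) ≤ n → ReflTransGen (starRel T) z y from
    key d x (fun i => ⟨min_le_left _ _, le_max_left _ _⟩) ((card_filter_le _ _).trans (by simp))
  intro n
  induction n with
  | zero =>
    intro z _ hn
    have : z = y := funext fun k => by
      by_contra hk
      have : 0 < #(univ.filter fun k => z k ≠ y k) := card_pos.2 ⟨k, mem_filter.2 ⟨mem_univ k, hk⟩⟩
      omega
    subst this
    exact ReflTransGen.refl
  | succ n ih =>
    intro z hz hn
    by_cases hall : ∀ k, z k = y k
    · have : z = y := funext hall
      subst this
      exact ReflTransGen.refl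
    · push Not at hall
      obtain ⟨k, hk⟩ := hall
      have hbetween : ∀ w : ℤ, min (z k) (y k) ≤ w ∧ w ≤ max (z k) (y k) →
          ∀ i, min (x i) (y i) ≤ Function.update z k w i ∧ Function.update z k w i ≤ max (x i) (y i) := by
        intro w hw i
        by_cases hik : i = k
        · subst hik
          rw [Function.update_self]
          have := hz i
          constructor
          · exact le_trans (le_min this.1 (min_le_right _ _)) hw.1
          · exact le_trans hw.2 (max_le this.2 (le_max_right _ _))
        · rw [Function.update_of_ne hik]; exact hz i
      have hstep : ReflTransGen (starRel T) z (Function.update z k (y k)) :=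
        reflTransGen_update_of_forall_between z k (y k) fun w hw => hT _ (hbetween w hw)
      refine hstep.trans (ih _ (hbetween (y k) ⟨min_le_right _ _, le_max_right _ _⟩) ?_)
      have hset : (univ.filter fun k' => Function.update z k (y k) k' ≠ y k') =
          (univ.filter fun k' => z k' ≠ y k').erase k := by
        ext k'
        simp only [mem_filter, mem_univ, true_and, mem_erase]
        by_cases hk' : k' = k
        · subst hk'; simp
        · rw [Function.update_of_ne hk']; tauto
      rw [hset, card_erase_of_mem (mem_filter.2 ⟨mem_univ k, hk⟩)]
      omega

/-- The straight chain from `x` to `y` stays within sup-distance `supDist x y` of `x`. [folklore] -/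
theorem reflTransGen_starRel_supDist_le (x y : Site d) :
    ReflTransGen (starRel {z | supDist x z ≤ supDist x y}) x y := by
  refine reflTransGen_starRel_of_between x y fun z hz => ?_
  simp only [Set.mem_setOf_eq, supDist_le_iff]
  intro i
  have h1 := natAbs_sub_le_supDist x y i
  have h2 := hz i
  rcases le_total (x i) (y i) with h | h
  · rw [min_eq_left h, max_eq_right h] at h2; omega
  · rw [min_eq_right h, max_eq_left h] at h2; omega

/-- Membership in a box in terms of the sup-distance to the origin. [folklore] -/
theorem mem_box_iff_supDist {n : ℕ} {z : Site d} : z ∈ box d n ↔ supDist 0 z ≤ n := by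
  rw [mem_box, supDist_le_iff]
  refine forall_congr' fun i => ?_
  simp only [Pi.zero_apply, zero_sub, Int.natAbs_neg]
  omega

/-- A `★`-neighbour of a point of `box n` lies in `box (n+1)`. [folklore] -/
theorem mem_box_succ_of_zdStar_adj {n : ℕ} {z z' : Site d} (hz : z ∈ box d n) (h : (zdStar d).Adj z z') :
    z' ∈ box d (n + 1) := by
  rw [mem_box_iff_supDist] at hz ⊢
  exact (supDist_le_succ_of_adj h).trans (by omega)

/-! ### Hull, exterior and the two boundaries -/

/-- A hull point `★`-adjacent to an exterior point belongs to the set itself.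
[cite: FriedliVelenik2017, §7.2.6] -/
theorem mem_of_mem_starHull_of_adj {A : Finset (Site d)} {z z' : Site d} (hz : z ∈ starHull A)
    (hz' : z' ∈ starExt A) (hadj : (zdStar d).Adj z z') : z ∈ A := by
  by_contra hzA
  exact hz (mem_starExt_of_reflTransGen hz' (ReflTransGen.single ⟨hadj.symm, hz'.1, hzA⟩))

/-- Points of the interior hull boundary: points of `A` with an exterior `★`-neighbour.
[cite: FriedliVelenik2017, §7.2.6, Lemma 7.19] -/
theorem mem_inBoundary_starHullFinset (hd : 2 ≤ d) {A : Finset (Site d)} {w : Site d}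
    (hw : w ∈ inBoundary (starHullFinset A)) : w ∈ A ∧ ∃ y ∈ starExt A, (zdStar d).Adj w y := by
  obtain ⟨hwH, y, hyH, hadj⟩ := mem_inBoundary.1 hw
  rw [mem_starHullFinset hd] at hwH hyH
  have hy : y ∈ starExt A := not_not.1 hyH
  exact ⟨mem_of_mem_starHull_of_adj hwH hy hadj, y, hy, hadj⟩

/-- A point of `A` with an exterior `★`-neighbour lies in the interior hull boundary.
[cite: FriedliVelenik2017, §7.2.6, Lemma 7.19] -/
theorem mem_inBoundary_starHullFinset_of (hd : 2 ≤ d) {A : Finset (Site d)} {w y : Site d} (hw : w ∈ A)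
    (hy : y ∈ starExt A) (hadj : (zdStar d).Adj w y) : w ∈ inBoundary (starHullFinset A) := by
  refine mem_inBoundary.2 ⟨(mem_starHullFinset hd).2 (subset_starHull A (mem_coe.2 hw)), y, ?_, hadj⟩
  rw [mem_starHullFinset hd]
  exact fun h => h hy

/-- Points of the exterior hull boundary: exterior points with a `★`-neighbour in `A`.
[cite: FriedliVelenik2017, §7.2.6, Lemma 7.19] -/
theorem mem_exBoundary_starHullFinset (hd : 2 ≤ d) {A : Finset (Site d)} {w : Site d}
    (hw : w ∈ exBoundary (starHullFinset A)) : w ∈ starExt A ∧ ∃ a ∈ A, (zdStar d).Adj a w := by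
  obtain ⟨hwH, z, hzH, hadj⟩ := mem_exBoundary.1 hw
  rw [mem_starHullFinset hd] at hwH hzH
  have hwE : w ∈ starExt A := not_not.1 hwH
  exact ⟨hwE, z, mem_of_mem_starHull_of_adj hzH hwE hadj, hadj⟩

/-- An exterior point `★`-adjacent to a hull point lies in the exterior hull boundary.
[cite: FriedliVelenik2017, §7.2.6, Lemma 7.19] -/
theorem mem_exBoundary_starHullFinset_of (hd : 2 ≤ d) {A : Finset (Site d)} {w z : Site d}
    (hw : w ∈ starExt A) (hz : z ∈ starHull A) (hadj : (zdStar d).Adj z w) :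
    w ∈ exBoundary (starHullFinset A) := by
  refine mem_exBoundary.2 ⟨fun h => ((mem_starHullFinset hd).1 h) hw, z, (mem_starHullFinset hd).2 hz, hadj⟩

/-- **Rays to the exterior, upward**: a point lying strictly beyond `A` in some coordinate is exterior
(move that coordinate up to the far region). [cite: FriedliVelenik2017, §7.2.6] -/
theorem mem_starExt_of_forall_lt (hd : 2 ≤ d) {A : Finset (Site d)} {z : Site d} (i : Fin d)
    (hz : ∀ a ∈ A, a i < z i) : z ∈ starExt A := by
  set R := boxRadius A
  have hA : A ⊆ box d R := subset_box_boxRadius A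
  set T : ℕ := R + (z i).natAbs + 1 with hT
  refine (mem_starExt_iff hd hA).2 ⟨fun h => lt_irrefl _ (hz z h), Function.update z i (z i + T), ?_, ?_⟩
  · refine ⟨i, ?_⟩
    rw [Function.update_self]
    omega
  · refine reflTransGen_update_add z i T fun m _ hmem => ?_
    have := hz _ hmem
    rw [Function.update_self] at this
    omega

/-- **Rays to the exterior, downward**: a point lying strictly below `A` in some coordinate is exterior.
[cite: FriedliVelenik2017, §7.2.6] -/
theorem mem_starExt_of_forall_gt (hd : 2 ≤ d) {A : Finset (Site d)} {z : Site d} (i : Fin d)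
    (hz : ∀ a ∈ A, z i < a i) : z ∈ starExt A := by
  set R := boxRadius A
  have hA : A ⊆ box d R := subset_box_boxRadius A
  set T : ℕ := R + (z i).natAbs + 1 with hT
  refine (mem_starExt_iff hd hA).2 ⟨fun h => lt_irrefl _ (hz z h), Function.update z i (z i - T), ?_, ?_⟩
  · refine ⟨i, ?_⟩
    rw [Function.update_self]
    omega
  · refine reflTransGen_update_sub z i T fun m _ hmem => ?_
    have := hz _ hmem
    rw [Function.update_self] at this
    omega

/-! ### `★`-components -/

/-- The `★`-component of `x` inside `T`: the points chained to `x` inside `T`. [folklore] -/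
def starComp (T : Set (Site d)) (x : Site d) : Set (Site d) := {z | ReflTransGen (starRel T) x z}

/-- `x` lies in its component. [folklore] -/
theorem mem_starComp_self (T : Set (Site d)) (x : Site d) : x ∈ starComp T x := ReflTransGen.refl

/-- The component of a point of `T` lies in `T`. [folklore] -/
theorem starComp_subset {T : Set (Site d)} {x : Site d} (hx : x ∈ T) : starComp T x ⊆ T :=
  fun _ hz => mem_of_reflTransGen_starRel hz hx

/-- Components are closed under `★`-steps inside `T`. [folklore] -/
theorem mem_starComp_of_adj {T : Set (Site d)} {x z z' : Site d} (hx : x ∈ T) (hz : z ∈ starComp T x)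
    (hz' : z' ∈ T) (hadj : (zdStar d).Adj z z') : z' ∈ starComp T x :=
  ReflTransGen.tail hz ⟨hadj, starComp_subset hx hz, hz'⟩

/-- A chain inside `T` from `x` is a chain inside the component. [folklore] -/
theorem reflTransGen_starComp {T : Set (Site d)} {x z : Site d} (hx : x ∈ T) (hz : z ∈ starComp T x) :
    ReflTransGen (starRel (starComp T x)) x z :=
  reflTransGen_starRel_restrict (fun _ ha _ hab => mem_starComp_of_adj hx ha hab.2.2 hab.1) (mem_starComp_self T x) hz

/-- Components are `★`-connected. [folklore] -/
theorem starConn_starComp {T : Set (Site d)} {x : Site d} (hx : x ∈ T) : StarConn (starComp T x) :=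
  fun _ hu _ hv => (reflTransGen_starRel_symm (reflTransGen_starComp hx hu)).trans (reflTransGen_starComp hx hv)

/-- A `★`-connected subset of `T` meeting the component lies in it. [folklore] -/
theorem subset_starComp_of_starConn {T C : Set (Site d)} {x : Site d} (hC : StarConn C)
    (hCT : C ⊆ T) {z : Site d} (hzC : z ∈ C) (hz : z ∈ starComp T x) : C ⊆ starComp T x :=
  fun _ hw => hz.trans (reflTransGen_starRel_mono hCT (hC z hzC _ hw))

/-- An infinite component leaves every box. [folklore] -/
theorem exists_mem_starComp_not_mem_box {T : Set (Site d)} {x : Site d} (h : (starComp T x).Infinite)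
    (n : ℕ) : ∃ z ∈ starComp T x, z ∉ box d n := by
  by_contra hall
  push Not at hall
  exact h ((box d n).finite_toSet.subset fun z hz => mem_coe.2 (hall z hz))

/-- The finset of an infinite... (helper) the coercion of `Set.Finite.toFinset` of a component. [folklore] -/
theorem coe_toFinset_starComp {T : Set (Site d)} {x : Site d} (h : (starComp T x).Finite) :
    (h.toFinset : Set (Site d)) = starComp T x := Set.Finite.coe_toFinset h

/-! ### The three-colour structure and the contour lemma -/

section Contour

variable (hd : 2 ≤ d) {Bad Plus : Set (Site d)}
  (hsep : ∀ a c : Site d, (zdStar d).Adj a c → a ∈ Plus → c ∉ Plus → c ∈ Bad)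

include hd hsep

/-- **Case 1: the non-plus component of `x` is finite.** The interior `★`-boundary `W` of its
`★`-hull is a `★`-connected set of bad blocks inside the component, containing for every coordinate
a block maximising and a block minimising that coordinate over the component.
[cite: FriedliVelenik2017, §7.2.6, Lemma 7.19] -/
theorem inBoundary_hull_comp_spec {x : Site d} (hxP : x ∉ Plus) (hU : (starComp Plusᶜ x).Finite) :
    StarConn (inBoundary (starHullFinset hU.toFinset) : Set (Site d)) ∧
    (∀ w ∈ inBoundary (starHullFinset hU.toFinset), w ∈ Bad ∧ w ∈ hU.toFinset) ∧
    (∀ i : Fin d, ∃ w ∈ inBoundary (starHullFinset hU.toFinset), ∀ u ∈ hU.toFinset, u i ≤ w i) ∧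
    (∀ i : Fin d, ∃ w ∈ inBoundary (starHullFinset hU.toFinset), ∀ u ∈ hU.toFinset, w i ≤ u i) := by
  set UF := hU.toFinset with hUF
  have hxc : x ∈ (Plusᶜ : Set (Site d)) := hxP
  have hmemUF : ∀ {z}, z ∈ UF ↔ z ∈ starComp Plusᶜ x := fun {z} => Set.Finite.mem_toFinset hU
  have hUconn : StarConn (UF : Set (Site d)) := by
    rw [hUF, coe_toFinset_starComp]; exact starConn_starComp hxc
  have hxUF : x ∈ UF := hmemUF.2 (mem_starComp_self _ x)
  refine ⟨(starConn_boundaries_starHull hd hUconn).2, fun w hw => ?_, fun i => ?_, fun i => ?_⟩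
  · obtain ⟨hwA, y, hy, hadj⟩ := mem_inBoundary_starHullFinset hd hw
    refine ⟨?_, hwA⟩
    have hwU : w ∈ starComp Plusᶜ x := hmemUF.1 hwA
    have hwP : w ∉ Plus := starComp_subset hxc hwU
    have hyU : y ∉ starComp Plusᶜ x := fun h => hy.1 (hmemUF.2 h)
    have hyP : y ∈ Plus := by
      by_contra hyP
      exact hyU (mem_starComp_of_adj hxc hwU hyP hadj)
    exact hsep y w hadj.symm hyP hwP
  · obtain ⟨u₀, hu₀, hmax⟩ := Finset.exists_max_image UF (fun u => u i) ⟨x, hxUF⟩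
    refine ⟨u₀, mem_inBoundary_starHullFinset_of hd hu₀ (y := Function.update u₀ i (u₀ i + 1)) ?_ ?_, hmax⟩
    · refine mem_starExt_of_forall_lt hd i fun a ha => ?_
      rw [Function.update_self]
      have := hmax a ha; omega
    · exact adj_update_succ u₀ i (u₀ i) |> fun h => by rwa [Function.update_eq_self] at h
  · obtain ⟨u₀, hu₀, hmin⟩ := Finset.exists_min_image UF (fun u => u i) ⟨x, hxUF⟩
    refine ⟨u₀, mem_inBoundary_starHullFinset_of hd hu₀ (y := Function.update u₀ i (u₀ i - 1)) ?_ ?_, hmin⟩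
    · refine mem_starExt_of_forall_gt hd i fun a ha => ?_
      rw [Function.update_self]
      have := hmin a ha; omega
    · have h := (adj_update_succ u₀ i (u₀ i - 1)).symm
      rwa [sub_add_cancel, Function.update_eq_self] at h

/-- **Case 1, quantitative**: with a non-plus `★`-chain from `x` reaching sup-distance `≥ m`, the set
`W` of Case 1 has at least `m + 1` blocks and all its blocks are within sup-distance `#W - 1` of `x`.
[cite: FriedliVelenik2017, §7.2.6, Lemma 7.19] -/
theorem card_inBoundary_hull_comp {x : Site d} (hxP : x ∉ Plus) (hU : (starComp Plusᶜ x).Finite)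
    {m : ℕ} (hx : ∃ z, ReflTransGen (starRel Plusᶜ) x z ∧ m ≤ supDist x z) :
    m + 1 ≤ #(inBoundary (starHullFinset hU.toFinset)) ∧
      ∀ w ∈ inBoundary (starHullFinset hU.toFinset), supDist x w + 1 ≤ #(inBoundary (starHullFinset hU.toFinset)) := by
  obtain ⟨hWconn, hWbad, hWmax, hWmin⟩ := inBoundary_hull_comp_spec hd hsep hxP hU
  set W := inBoundary (starHullFinset hU.toFinset)
  have hmemUF : ∀ {z}, z ∈ hU.toFinset ↔ z ∈ starComp Plusᶜ x := fun {z} => Set.Finite.mem_toFinset hU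
  have hxUF : x ∈ hU.toFinset := hmemUF.2 (mem_starComp_self _ x)
  -- coordinate extents of the component are controlled by `#W`
  have hext : ∀ (i : Fin d) (u v : Site d), u ∈ hU.toFinset → v ∈ hU.toFinset → (u i - v i).natAbs + 1 ≤ #W := by
    intro i u v hu hv
    obtain ⟨wM, hwM, hM⟩ := hWmax i
    obtain ⟨wm, hwm, hm⟩ := hWmin i
    have h1 := natAbs_sub_lt_card_of_starConn hWconn hwM hwm i
    have := hM u hu; have := hM v hv; have := hm u hu; have := hm v hv
    omega
  have hd0 : 0 < d := by omega
  have hsup : ∀ u v : Site d, u ∈ hU.toFinset → v ∈ hU.toFinset → supDist u v + 1 ≤ #W := by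
    intro u v hu hv
    obtain ⟨i, -, hi⟩ := Finset.exists_mem_eq_sup (univ : Finset (Fin d)) ⟨⟨0, hd0⟩, mem_univ _⟩
      (fun i => (u i - v i).natAbs)
    change supDist u v = _ at hi
    rw [hi]; exact hext i u v hu hv
  refine ⟨?_, fun w hw => hsup x w hxUF (hWbad w hw).2⟩
  obtain ⟨z, hz, hmz⟩ := hx
  have := hsup x z hxUF (hmemUF.2 hz)
  omega

/-- **Case 2: the plus component of `y` is finite** (and the sup-ball of radius `r` about `y` is plus).
The exterior `★`-boundary `W` of its `★`-hull is a `★`-connected set of bad blocks with at least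
`2r + 3` blocks, each within sup-distance `#W - 2` of `y`. [cite: FriedliVelenik2017, §7.2.6, Lemma 7.19] -/
theorem exBoundary_hull_comp_spec {y : Site d} {r : ℕ} (hy : ∀ z, supDist y z ≤ r → z ∈ Plus)
    (hV : (starComp Plus y).Finite) :
    StarConn (exBoundary (starHullFinset hV.toFinset) : Set (Site d)) ∧
    (∀ w ∈ exBoundary (starHullFinset hV.toFinset), w ∈ Bad) ∧
    2 * r + 3 ≤ #(exBoundary (starHullFinset hV.toFinset)) ∧
    (∀ w ∈ exBoundary (starHullFinset hV.toFinset), supDist y w + 2 ≤ #(exBoundary (starHullFinset hV.toFinset))) := by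
  set VF := hV.toFinset with hVF
  set HF := starHullFinset VF with hHF
  set W := exBoundary HF with hW
  have hyP : y ∈ Plus := hy y (by simp)
  have hmemVF : ∀ {z}, z ∈ VF ↔ z ∈ starComp Plus y := fun {z} => Set.Finite.mem_toFinset hV
  have hVconn : StarConn (VF : Set (Site d)) := by
    rw [hVF, coe_toFinset_starComp]; exact starConn_starComp hyP
  have hyVF : y ∈ VF := hmemVF.2 (mem_starComp_self _ y)
  have hVH : VF ⊆ HF := fun z hz => (mem_starHullFinset hd).2 (subset_starHull VF (mem_coe.2 hz))
  have hyHF : y ∈ HF := hVH hyVF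
  have hWconn : StarConn (W : Set (Site d)) := (starConn_boundaries_starHull hd hVconn).1
  -- `W` is bad
  have hWbad : ∀ w ∈ W, w ∈ Bad := by
    intro w hw
    obtain ⟨hwE, a, ha, hadj⟩ := mem_exBoundary_starHullFinset hd hw
    have haV : a ∈ starComp Plus y := hmemVF.1 ha
    have haP : a ∈ Plus := starComp_subset hyP haV
    have hwVF : w ∉ VF := hwE.1
    have hwP : w ∉ Plus := fun hwP => hwVF (hmemVF.2 (mem_starComp_of_adj hyP haV hwP hadj))
    exact hsep a w hadj haP hwP
  -- the ball of radius `r` lies in the component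
  have hball : ∀ z, supDist y z ≤ r → z ∈ VF := by
    intro z hz
    refine hmemVF.2 (reflTransGen_starRel_mono (fun v (hv : supDist y v ≤ supDist y z) => hy v (hv.trans hz))
      (reflTransGen_starRel_supDist_le y z))
  -- extreme points of the hull, pushed one step out, are in `W`
  have hWmax : ∀ i : Fin d, ∃ w ∈ W, ∀ h ∈ HF, h i + 1 ≤ w i := by
    intro i
    obtain ⟨h₀, hh₀, hmax⟩ := Finset.exists_max_image HF (fun h => h i) ⟨y, hyHF⟩
    refine ⟨Function.update h₀ i (h₀ i + 1), mem_exBoundary_starHullFinset_of hd ?_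
      ((mem_starHullFinset hd).1 hh₀) (adj_update_succ h₀ i (h₀ i) |> fun h => by rwa [Function.update_eq_self] at h), ?_⟩
    · refine mem_starExt_of_forall_lt hd i fun a ha => ?_
      rw [Function.update_self]
      have := hmax a (hVH ha); omega
    · intro h hh
      rw [Function.update_self]
      have := hmax h hh; omega
  have hWmin : ∀ i : Fin d, ∃ w ∈ W, ∀ h ∈ HF, w i + 1 ≤ h i := by
    intro i
    obtain ⟨h₀, hh₀, hmin⟩ := Finset.exists_min_image HF (fun h => h i) ⟨y, hyHF⟩
    have hadj : (zdStar d).Adj h₀ (Function.update h₀ i (h₀ i - 1)) := by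
      have h := (adj_update_succ h₀ i (h₀ i - 1)).symm
      rwa [sub_add_cancel, Function.update_eq_self] at h
    refine ⟨Function.update h₀ i (h₀ i - 1), mem_exBoundary_starHullFinset_of hd ?_
      ((mem_starHullFinset hd).1 hh₀) hadj, ?_⟩
    · refine mem_starExt_of_forall_gt hd i fun a ha => ?_
      rw [Function.update_self]
      have := hmin a (hVH ha); omega
    · intro h hh
      rw [Function.update_self]
      have := hmin h hh; omega
  -- extents
  have hext : ∀ (i : Fin d) (u v : Site d), u ∈ HF → v ∈ HF → (u i - v i).natAbs + 3 ≤ #W := by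
    intro i u v hu hv
    obtain ⟨wM, hwM, hM⟩ := hWmax i
    obtain ⟨wm, hwm, hm⟩ := hWmin i
    have h1 := natAbs_sub_lt_card_of_starConn hWconn hwM hwm i
    have := hM u hu; have := hM v hv; have := hm u hu; have := hm v hv
    omega
  have hd0 : 0 < d := by omega
  have hsup : ∀ u v : Site d, u ∈ HF → v ∈ HF → supDist u v + 3 ≤ #W := by
    intro u v hu hv
    obtain ⟨i, -, hi⟩ := Finset.exists_mem_eq_sup (univ : Finset (Fin d)) ⟨⟨0, hd0⟩, mem_univ _⟩
      (fun i => (u i - v i).natAbs)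
    change supDist u v = _ at hi
    rw [hi]; exact hext i u v hu hv
  refine ⟨hWconn, hWbad, ?_, fun w hw => ?_⟩
  · -- the two poles of the ball
    set i : Fin d := ⟨0, hd0⟩
    have hp : Function.update y i (y i + r) ∈ HF := hVH (hball _ (by
      rw [supDist_le_iff]; intro j
      by_cases hj : j = i
      · subst hj; rw [Function.update_self]; omega
      · rw [Function.update_of_ne hj]; simp))
    have hq : Function.update y i (y i - r) ∈ HF := hVH (hball _ (by
      rw [supDist_le_iff]; intro j
      by_cases hj : j = i
      · subst hj; rw [Function.update_self]; omega
      · rw [Function.update_of_ne hj]; simp))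
    have h := hext i _ _ hp hq
    simp only [Function.update_self] at h
    have : (y i + r - (y i - r)).natAbs = 2 * r := by omega
    omega
  · obtain ⟨-, a, ha, hadj⟩ := mem_exBoundary_starHullFinset hd hw
    have h1 := hsup y a hyHF (hVH ha)
    have h2 := supDist_le_succ_of_adj (x := y) hadj
    omega

/-- **Case 3: both components are infinite.** Then there is a `★`-connected finite set of bad blocks
with at least `N` blocks (a bad `★`-chain of sup-diameter `≥ N` inside the interior hull boundary of a
large truncation of the non-plus component of `x`). [cite: FriedliVelenik2017, §7.2.6, Lemma 7.19] -/
theorem exists_starConn_bad_of_infinite {x y : Site d} (hxP : x ∉ Plus) (hyP : y ∈ Plus)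
    (hU : (starComp Plusᶜ x).Infinite) (hV : (starComp Plus y).Infinite) (N : ℕ) :
    ∃ C : Finset (Site d), StarConn (C : Set (Site d)) ∧ (∀ c ∈ C, c ∈ Bad) ∧ N ≤ #C := by
  classical
  have hxc : x ∈ (Plusᶜ : Set (Site d)) := hxP
  set ρ := supDist x y with hρ
  set n : ℕ := supDist 0 x + ρ + N + 3 with hn
  -- the truncated component
  set U := starComp Plusᶜ x with hUdef
  set T : Set (Site d) := U ∩ (box d n : Set (Site d)) with hTdef
  have hxbox : x ∈ box d n := mem_box_iff_supDist.2 (by omega)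
  have hxT : x ∈ T := ⟨mem_starComp_self _ x, hxbox⟩
  set A := starComp T x with hAdef
  have hAT : A ⊆ T := starComp_subset hxT
  have hAfin : A.Finite := (box d n).finite_toSet.subset fun z hz => (hAT hz).2
  set AF := hAfin.toFinset with hAF
  have hmemAF : ∀ {z}, z ∈ AF ↔ z ∈ A := fun {z} => Set.Finite.mem_toFinset hAfin
  have hAFbox : AF ⊆ box d n := fun z hz => mem_coe.1 (hAT (hmemAF.1 hz)).2
  have hAconn : StarConn (AF : Set (Site d)) := by rw [hAF, coe_toFinset_starComp]; exact starConn_starComp hxT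
  have hxAF : x ∈ AF := hmemAF.2 (mem_starComp_self _ x)
  set HF := starHullFinset AF with hHF
  set W := inBoundary HF with hWdef
  have hWconn : StarConn (W : Set (Site d)) := (starConn_boundaries_starHull hd hAconn).2
  -- points of `W` inside `box (n-1)` are bad
  have hWbad : ∀ w ∈ W, w ∈ box d (n - 1) → w ∈ Bad := by
    intro w hw hwbox
    obtain ⟨hwA, y', hy', hadj⟩ := mem_inBoundary_starHullFinset hd hw
    have hwA' : w ∈ A := hmemAF.1 hwA
    have hwU : w ∈ U := (hAT hwA').1
    have hwP : w ∉ Plus := starComp_subset hxc hwU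
    have hy'box : y' ∈ box d n := by
      have := mem_box_succ_of_zdStar_adj hwbox hadj
      rwa [show n - 1 + 1 = n by omega] at this
    have hy'A : y' ∉ A := fun h => hy'.1 (hmemAF.2 h)
    have hy'U : y' ∉ U := fun h => hy'A (mem_starComp_of_adj hxT hwA' ⟨h, hy'box⟩ hadj)
    have hy'P : y' ∈ Plus := by
      by_contra h
      exact hy'U (mem_starComp_of_adj hxc hwU h hadj)
    exact hsep y' w hadj.symm hy'P hwP
  -- a point of `W` near `x`: where the straight chain from `x` to `y` leaves the hull
  have hyE : y ∈ starExt AF := by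
    obtain ⟨v, hv, hvbox⟩ := exists_mem_starComp_not_mem_box hV (boxRadius AF)
    have hvE : v ∈ starExt AF := mem_starExt_of_not_mem_box hd (subset_box_boxRadius AF) hvbox
    have hdisj : Disjoint (starComp Plus y) (AF : Set (Site d)) := by
      rw [Set.disjoint_left]
      intro z hz hzA
      exact starComp_subset hxc (hAT (hmemAF.1 hzA)).1 (starComp_subset hyP hz)
    exact subset_starExt_of_starConn (starConn_starComp hyP) hdisj hv hvE (mem_starComp_self _ y)
  obtain ⟨w₀, w₀', hch₀, hw₀S, hw₀H, -, hw₀'H, hadj₀⟩ :=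
    exists_exit_of_reflTransGen (H := starHull AF) (reflTransGen_starRel_supDist_le x y)
      (show supDist x x ≤ supDist x y by simp) (subset_starHull AF (mem_coe.2 hxAF)) (fun h => h hyE)
  have hw₀W : w₀ ∈ W :=
    mem_inBoundary_starHullFinset_of hd (mem_of_mem_starHull_of_adj hw₀H (not_not.1 hw₀'H) hadj₀)
      (not_not.1 hw₀'H) hadj₀
  have hw₀near : supDist 0 w₀ ≤ supDist 0 x + ρ := by
    have := supDist_triangle 0 x w₀
    have h2 : supDist x w₀ ≤ ρ := hw₀S
    omega
  -- a point of `W` far from `x`: where a chain of `U` leaving `box n` exits the box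
  obtain ⟨u, hu, hubox⟩ := exists_mem_starComp_not_mem_box hU n
  obtain ⟨w₂, w₃, hch₂, hw₂U, hw₂box, hw₃U, hw₃box, hadj₂⟩ :=
    exists_exit_of_reflTransGen (H := (box d n : Set (Site d))) (reflTransGen_starComp hxc hu)
      (mem_starComp_self _ x) hxbox hubox
  have hw₂A : w₂ ∈ A := by
    have : ReflTransGen (starRel T) x w₂ := hch₂
    exact this
  have hw₂W : w₂ ∈ W :=
    mem_inBoundary_starHullFinset_of hd (hmemAF.2 hw₂A) (mem_starExt_of_not_mem_box hd hAFbox hw₃box) hadj₂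
  have hw₂far : w₂ ∉ box d (n - 2) := by
    intro h
    have := mem_box_succ_of_zdStar_adj h hadj₂
    exact hw₃box (box_mono _ (by omega) this)
  -- the chain inside `W` from `w₀` to `w₂`, stopped at the first exit from `box (n-2)`
  have hw₀box : w₀ ∈ box d (n - 2) := mem_box_iff_supDist.2 (by omega)
  obtain ⟨w₄, w₅, hch₄, -, hw₄box, -, hw₅box, hadj₄⟩ :=
    exists_exit_of_reflTransGen (H := (box d (n - 2) : Set (Site d))) (hWconn w₀ (mem_coe.2 hw₀W) w₂ (mem_coe.2 hw₂W))
      (mem_coe.2 hw₀W) hw₀box hw₂far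
  -- the bad chain
  set C := starComp ((W : Set (Site d)) ∩ (box d (n - 2) : Set (Site d))) w₀ with hCdef
  have hw₀C' : w₀ ∈ (W : Set (Site d)) ∩ (box d (n - 2) : Set (Site d)) := ⟨hw₀W, hw₀box⟩
  have hCsub : C ⊆ (W : Set (Site d)) ∩ (box d (n - 2) : Set (Site d)) := starComp_subset hw₀C'
  have hCfin : C.Finite := (box d (n - 2)).finite_toSet.subset fun z hz => (hCsub hz).2
  refine ⟨hCfin.toFinset, ?_, fun c hc => ?_, ?_⟩
  · rw [coe_toFinset_starComp]; exact starConn_starComp hw₀C'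
  · have hc' : c ∈ C := (Set.Finite.mem_toFinset hCfin).1 hc
    exact hWbad c (hCsub hc').1 (box_mono _ (by omega) (mem_coe.1 (hCsub hc').2))
  · have hw₄C : w₄ ∈ C := hch₄
    have hw₄far : n - 3 ≤ supDist 0 w₄ := by
      by_contra hlt
      have h4 : w₄ ∈ box d (n - 3) := mem_box_iff_supDist.2 (by omega)
      have := mem_box_succ_of_zdStar_adj h4 hadj₄
      exact hw₅box (box_mono _ (by omega) this)
    have hCconn : StarConn (hCfin.toFinset : Set (Site d)) := by
      rw [coe_toFinset_starComp]; exact starConn_starComp hw₀C'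
    have h := supDist_lt_card_of_starConn hCconn ((Set.Finite.mem_toFinset hCfin).2 (mem_starComp_self _ w₀))
      ((Set.Finite.mem_toFinset hCfin).2 hw₄C)
    have htri := supDist_triangle 0 w₀ w₄
    omega

/-- **The contour lemma** (geometric step of the chessboard–Peierls argument; cf. Friedli–Velenik
§10.4.2, Fröhlich–Lieb 1978 §3). In a three-colouring of `ℤ^{d★}` (`d ≥ 2`) into bad, plus and minus
blocks in which a non-plus `★`-neighbour of a plus block is bad: if a `★`-chain of non-plus blocks from
the non-plus block `x` reaches sup-distance `≥ m` and the sup-ball of radius `r` about `y` is plus,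
then for every `N ≥ 1` there is a `★`-connected finite set `W` of bad blocks with (a) `#W = N`, or
(b) `m + 1 ≤ #W < N` and a block of `W` within sup-distance `#W - 1` of `x`, or (c) `r + 1 ≤ #W < N`
and a block of `W` within sup-distance `#W - 1` of `y`. [cite: FriedliVelenik2017, §10.4.2 and Lemma 7.19] -/
theorem exists_starConn_bad_of_chain {N : ℕ} (hN : 1 ≤ N) {x y : Site d} (hxP : x ∉ Plus) {m r : ℕ}
    (hx : ∃ z, ReflTransGen (starRel Plusᶜ) x z ∧ m ≤ supDist x z)
    (hy : ∀ z, supDist y z ≤ r → z ∈ Plus) :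
    ∃ W : Finset (Site d), StarConn (W : Set (Site d)) ∧ (∀ w ∈ W, w ∈ Bad) ∧
      (#W = N ∨ (m + 1 ≤ #W ∧ #W < N ∧ ∃ w ∈ W, supDist x w + 1 ≤ #W) ∨
        (r + 1 ≤ #W ∧ #W < N ∧ ∃ w ∈ W, supDist y w + 1 ≤ #W)) := by
  -- extraction of exactly `N` blocks from a large bad `★`-connected set
  have extract : ∀ W : Finset (Site d), StarConn (W : Set (Site d)) → (∀ w ∈ W, w ∈ Bad) → N ≤ #W →
      ∃ W' : Finset (Site d), StarConn (W' : Set (Site d)) ∧ (∀ w ∈ W', w ∈ Bad) ∧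
        (#W' = N ∨ (m + 1 ≤ #W' ∧ #W' < N ∧ ∃ w ∈ W', supDist x w + 1 ≤ #W') ∨
          (r + 1 ≤ #W' ∧ #W' < N ∧ ∃ w ∈ W', supDist y w + 1 ≤ #W')) := by
    intro W hWc hWb hNW
    obtain ⟨T, hTW, hTN, hTc⟩ := exists_subset_card_eq_of_starConn hWc hN hNW
    exact ⟨T, hTc, fun w hw => hWb w (hTW hw), Or.inl hTN⟩
  by_cases hU : (starComp Plusᶜ x).Finite
  · obtain ⟨hWc, hWb, -, -⟩ := inBoundary_hull_comp_spec hd hsep hxP hU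
    obtain ⟨hm, hdist⟩ := card_inBoundary_hull_comp hd hsep hxP hU hx
    set W := inBoundary (starHullFinset hU.toFinset)
    by_cases hWN : #W < N
    · have hne : W.Nonempty := card_pos.1 (by omega)
      obtain ⟨w, hw⟩ := hne
      exact ⟨W, hWc, fun w hw => (hWb w hw).1, Or.inr (Or.inl ⟨hm, hWN, w, hw, hdist w hw⟩)⟩
    · exact extract W hWc (fun w hw => (hWb w hw).1) (not_lt.1 hWN)
  · have hyP : y ∈ Plus := hy y (by simp)
    by_cases hV : (starComp Plus y).Finite
    · obtain ⟨hWc, hWb, hr, hdist⟩ := exBoundary_hull_comp_spec hd hsep hy hV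
      set W := exBoundary (starHullFinset hV.toFinset)
      by_cases hWN : #W < N
      · have hne : W.Nonempty := card_pos.1 (by omega)
        obtain ⟨w, hw⟩ := hne
        exact ⟨W, hWc, hWb, Or.inr (Or.inr ⟨by omega, hWN, w, hw, by have := hdist w hw; omega⟩)⟩
      · exact extract W hWc hWb (not_lt.1 hWN)
    · obtain ⟨C, hCc, hCb, hNC⟩ := exists_starConn_bad_of_infinite hd hsep hxP hyP hU hV N
      exact extract C hCc hCb hNC

end Contour

end Literature.Barriers.CriticalPhenomena.NonGibbs

end
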